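import Summits.HodgeConjecture.CorCM.Model.CupAlgebraic
import Summits.HodgeConjecture.CorCM.RationalExteriorAlgebra
import Summits.HodgeConjecture.CorCM.KunnethDegreeOne
import Literature.AlgebraicGeometry.HodgeTheory.AbelianVarietyEndomorphismsHOne
import Literature.AlgebraicGeometry.Motives.AbelianVarietyProduct
import Literature.AlgebraicGeometry.Motives.AbelianVarietyExterior
import Literature.AlgebraicTopology.CharacteristicClasses.ProjectiveSpaceLerayHirsch
import HarnessLib

/-!
# COR-CM model layer, row M22 `Fact_algDuality`, kernel K-b: the Poincaré (polarization) class
# `ℓ = m^*θ - pr₁^*θ - pr₂^*θ` of a complex abelian variety on the Betti carriers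

Cell `pub-hodgecm2` (COR-CM = stage 2 of the Hodge ladder), seat `b16`; `BINDER-OWNERS.md` row M22, kernel **K-b** of the
lead's F-1 (ii) plan (M22 is PROVED in the tree: K-a = model-1, K-b = this file, K-c = b17, R2 = b26).  TEMPLATE: the
abstract Weil-cohomology file `Literature/AlgebraicGeometry/Motives/AbelianVarietyExterior.lean` (`polClass` :711,
`polClass_eq` :753, `polClass_mem_ratAlgebraicClasses` :775, `polClass_eq_sum` :784, `pow_polClass_eq_sum` :842), there
over an abstract `W : WeilCohomology k K` with its Hopf-algebra structure; HERE on the real carriers of the Picard–CM model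
universe: `bettiCohomology X k = Hᵏ(X(ℂ); ℚ)`, `BettiUniverse.pull`, `BettiUniverse.cup`, `PicardCM.ratAlgebraicClasses`, for
an arbitrary complex abelian variety `A : Motives.AbelianVariety ℂ` (the consumer instantiates `A` := the coded corner
product `P`).  No Künneth decomposition is used for the group law: `m^* = pr₁^* + pr₂^*` on `H¹` is proved TOPOLOGICALLY
(`m(ℂ) = pr₁(ℂ) · pr₂(ℂ)` pointwise in the path-connected topological group `A(ℂ)`, and the tree's
`HodgeTheory.singularCohomology.map_mul_one_of_field`).

## What is proved (definition-free; `ℓ(θ)` is always spelled out as `pull μ 2 θ - pull fst 2 θ - pull snd 2 θ`)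

* `pull_mu_one` — **`m^* = pr₁^* + pr₂^*` on `H¹(A(ℂ); ℚ)`** (Mumford §1 (2); Lange–Birkenhake §1.1).
* `polClass_mem_ratAlgebraicClasses` — `θ ∈ A¹(A)_ℚ ⇒ ℓ(θ) ∈ A¹(A × A)_ℚ` (pull-backs preserve rational algebraic classes).
* `polClass_cup_one_one` — `ℓ(x ∪ x') = pr₁^*x ∪ pr₂^*x' - pr₁^*x' ∪ pr₂^*x` for `x, x' ∈ H¹`.
* `exists_polClass_eq_sum` — for a basis `b` of `H¹(A(ℂ); ℚ)` indexed by `Fin n` and any `θ ∈ H²`: there is a family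
  `y : Fin n → H¹` (the **polar family** of `θ` along `b`) with `ℓ(θ) = Σ_a pr₁^*(b a) ∪ pr₂^*(y a)`.
* `cupPow_sum_cup_eq` — **Koszul expansion** (pure graded algebra, any space `T`): for degree-one classes
  `p q : Fin n → H¹(T; ℚ)`, `(Σ_a p_a ∪ q_a)^i = s_i • Σ_{c : Fin i → Fin n} m_i(p ∘ c) ∪ m_i(q ∘ c)` with the tree's
  iterated products `SingularHomology.cupPowOne` (degree `i`) and `CharacteristicClasses.cupPow` (degree `2 i`) and the
  Koszul sign `s_i = (-1)^{i(i-1)/2} = (-1) ^ (i.choose 2)` (`s₀ = 1`, `s_{i+1} = (-1)^i s_i`; the template's `altSign i`).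
* `sum_cup_pull_cupPowOne_mem_ratAlgebraicClasses` — hence, for `θ` algebraic with `ℓ(θ) = Σ_a pr₁^*b_a ∪ pr₂^*y_a`, the class
  `Σ_c pr₁^* m_i(b ∘ c) ∪ pr₂^* m_i(y ∘ c) = s_i ℓ(θ)^i` lies in `Aⁱ(A × A)_ℚ` — the algebraic correspondence inducing the
  Fourier-type operator `F(z) = Σ_c tr(z ∪ x_c) y_c` of K-a/K-c (template `isAlgebraicOperator_fourierOp` :920).

## References
* [MumfordAV1970] D. Mumford, *Abelian Varieties* (1970), §1 (2)–(4), §6 Cor. 3, §16.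
* [LangeBirkenhake1992] H. Lange, Ch. Birkenhake, *Complex Abelian Varieties* (1992), §1.1, Lemma 1.1.17; (2023 ed.) §6.2.4,
  Prop. 6.2.20.
* [Kleiman1968AlgebraicCycles] S. Kleiman, *Algebraic cycles and the Weil conjectures* (1968), App. 2A (2A8–2A11).
* [HatcherAT2002] A. Hatcher, *Algebraic Topology* (2002), §3.2 Thm. 3.11, §3.C Lemma 3C.3.
-/

noncomputable section

open CategoryTheory MonoidalCategory CartesianMonoidalCategory
open Literature.AlgebraicTopology.SingularHomology
open Literature.AlgebraicTopology.CharacteristicClasses (cupPow cupPow_zero cupPow_succ map_cupPow)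
open Literature.AlgebraicGeometry.Motives (SchemeOver ComplexPoints IsSmoothProjective bettiCohomology AbelianVariety
  AlgPoints WeilCohomology)
open Literature.AlgebraicGeometry.HodgeTheory
open Literature.NumberTheory.Automorphic.PicardCM

namespace Summit.HodgeConjecture.CorCM.Model

/-! ### `m^* = pr₁^* + pr₂^*` on `H¹` -/

section GroupLaw

open scoped MonObj

variable (A : AbelianVariety ℂ)

/-- On complex points, the product `f · g` of two morphisms `X → A` into the group scheme `A` (Mathlib's `Hom.monoid`:
`f · g = ⟨f, g⟩ ≫ μ`) is the pointwise product of `f(ℂ)` and `g(ℂ)` in the topological group `A(ℂ)` (evaluation at a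
point is a monoid homomorphism, `AlgPoints.map_mul`). [cite: MumfordAV1970, §1 (1)] -/
theorem mapContinuous_mul {X : SchemeOver ℂ} (f g : X ⟶ A.X) :
    AlgPoints.mapContinuous (L := ℂ) (f * g) =
      AlgPoints.mapContinuous (L := ℂ) f * AlgPoints.mapContinuous (L := ℂ) g :=
  ContinuousMap.ext fun P ↦ AlgPoints.map_mul f g P

/-- **The group law acts additively on `H¹`: `m^* = pr₁^* + pr₂^*`** as maps `H¹(A(ℂ); ℚ) → H¹((A × A)(ℂ); ℚ)`
(Mumford §1 (2): `m^*`, `pr₁^* + pr₂^*` agree on `H¹`; Lange–Birkenhake §1.1: the rational representation is additive).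
Proof on the carriers, without Künneth: `μ = pr₁ · pr₂` in `Hom(A × A, A)` (Mathlib `MonObj.mul_eq_mul`), so
`μ(ℂ) = pr₁(ℂ) · pr₂(ℂ)` pointwise in the path-connected topological group `A(ℂ)`, and pointwise products act additively
on `H¹(–; ℚ)` (`HodgeTheory.singularCohomology.map_mul_one_of_field`, Hatcher §3.C Lemma 3C.3 dualised).
[cite: MumfordAV1970, §1 (2)] [cite: LangeBirkenhake1992, §1.1 (p. 19)] -/
theorem pull_mu_one :
    BettiUniverse.pull μ[A.X] 1 =
      BettiUniverse.pull (fst A.X A.X) 1 + BettiUniverse.pull (snd A.X A.X) 1 := by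
  haveI : PathConnectedSpace (ComplexPoints (A.X ⊗ A.X)) :=
    AbelianVariety.Points.instPathConnectedSpace (A.prod A)
  rw [MonObj.mul_eq_mul]
  change (singularCohomology.map ℚ ℚ (AlgPoints.mapContinuous (L := ℂ) (fst A.X A.X * snd A.X A.X)) 1).hom = _
  rw [mapContinuous_mul, singularCohomology.map_mul_one_of_field]
  rfl

/-- Element form of `pull_mu_one`: `m^* x = pr₁^* x + pr₂^* x` for `x ∈ H¹(A(ℂ); ℚ)`. [cite: MumfordAV1970, §1 (2)] -/
theorem pull_mu_one_apply (x : bettiCohomology A.X 1) :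
    BettiUniverse.pull μ[A.X] 1 x =
      BettiUniverse.pull (fst A.X A.X) 1 x + BettiUniverse.pull (snd A.X A.X) 1 x := by
  rw [pull_mu_one, LinearMap.add_apply]

end GroupLaw

/-! ### The Poincaré class `ℓ(θ) = m^*θ - pr₁^*θ - pr₂^*θ`: algebraicity and the value on a cup of degree-one classes -/

section PolClass

open scoped MonObj

variable (A : AbelianVariety ℂ)

/-- **The Poincaré class of an algebraic class is algebraic**: for `θ ∈ A¹(A)_ℚ` (a rational algebraic class in
`H²(A(ℂ); ℚ)`), `m^*θ - pr₁^*θ - pr₂^*θ ∈ A¹(A × A)_ℚ` — pull-backs along morphisms of smooth projective varieties and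
differences preserve rational algebraic classes (Fulton Cor. 19.2 (b), the tree's `ratAlgebraicClasses_map_pull_le`).
Cohomologically this is `c₁` of the Mumford line bundle `m^*L ⊗ pr₁^*L⁻¹ ⊗ pr₂^*L⁻¹`. [cite: MumfordAV1970, §6 (Cor. 3 of the theorem of the cube)] -/
theorem polClass_mem_ratAlgebraicClasses {θ : bettiCohomology A.X 2} (hθ : θ ∈ ratAlgebraicClasses A.X 1) :
    BettiUniverse.pull μ[A.X] 2 θ - BettiUniverse.pull (fst A.X A.X) 2 θ - BettiUniverse.pull (snd A.X A.X) 2 θ ∈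
      ratAlgebraicClasses (A.X ⊗ A.X) 1 := by
  have hA : IsSmoothProjective A.dim A.X := AbelianVariety.isSmoothProjective_holds (A := A)
  have hAA : IsSmoothProjective (A.dim + A.dim) (A.X ⊗ A.X) := IsSmoothProjective.tensor_holds hA hA
  refine sub_mem (sub_mem ?_ ?_) ?_ <;>
    exact ratAlgebraicClasses_map_pull_le hA hAA _ 1 ⟨θ, hθ, rfl⟩

/-- `f^*(x ∪ y) = f^*x ∪ f^*y` in degree `(1,1)` with the target degree spelled `2` (the tree's `BettiUniverse.pull_cup`
at `i = j = 1`). [cite: HatcherAT2002, §3.2 Prop. 3.10] -/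
theorem pull_cup_one_one {X Y : SchemeOver ℂ} (f : X ⟶ Y) (x y : bettiCohomology Y 1) :
    BettiUniverse.pull f 2 (BettiUniverse.cup Y 1 1 x y) =
      BettiUniverse.cup X 1 1 (BettiUniverse.pull f 1 x) (BettiUniverse.pull f 1 y) :=
  BettiUniverse.pull_cup f 1 1 x y

/-- **The Poincaré class of a cup of two degree-one classes**: for `x, x' ∈ H¹(A(ℂ); ℚ)`,
`ℓ(x ∪ x') = pr₁^*x ∪ pr₂^*x' - pr₁^*x' ∪ pr₂^*x` (`m^*` is a ring map, `m^* = pr₁^* + pr₂^*` on `H¹`, and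
`pr₂^*x ∪ pr₁^*x' = -(pr₁^*x' ∪ pr₂^*x)` in degree `(1,1)`). [cite: MumfordAV1970, §1 (2)–(4)] -/
theorem polClass_cup_one_one (x x' : bettiCohomology A.X 1) :
    BettiUniverse.pull μ[A.X] 2 (BettiUniverse.cup A.X 1 1 x x') -
        BettiUniverse.pull (fst A.X A.X) 2 (BettiUniverse.cup A.X 1 1 x x') -
        BettiUniverse.pull (snd A.X A.X) 2 (BettiUniverse.cup A.X 1 1 x x') =
      BettiUniverse.cup (A.X ⊗ A.X) 1 1 (BettiUniverse.pull (fst A.X A.X) 1 x) (BettiUniverse.pull (snd A.X A.X) 1 x') -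
        BettiUniverse.cup (A.X ⊗ A.X) 1 1 (BettiUniverse.pull (fst A.X A.X) 1 x')
          (BettiUniverse.pull (snd A.X A.X) 1 x) := by
  rw [pull_cup_one_one, pull_cup_one_one, pull_cup_one_one, pull_mu_one_apply, pull_mu_one_apply,
    LinearMap.map_add₂, map_add, map_add,
    BettiUniverse.cup_comm_one (BettiUniverse.pull (snd A.X A.X) 1 x) (BettiUniverse.pull (fst A.X A.X) 1 x')]
  abel

end PolClass

/-! ### Koszul expansion of the powers of `Σ_a p_a ∪ q_a` (pure graded algebra on any space) -/

section Koszul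

variable {R : Type} [CommRing R] {T : Type} [TopologicalSpace T]

/-- **Four-term interchange with Koszul sign**: for classes `P, Q` of degree `i` and `p, q` of degree `1`,
`(P ∪ Q) ∪ (p ∪ q) = (-1)^i • (p ∪ P) ∪ (q ∪ Q)` (associativity and graded commutativity of the cup product,
Hatcher Thm. 3.11: three transpositions of a degree-`1` class past a degree-`i` class). [cite: HatcherAT2002, §3.2 Thm. 3.11] -/
theorem cup_cup_cup_cup_one_one {i : ℕ} (P Q : singularCohomology R R T i) (p q : singularCohomology R R T 1) :
    cupProduct (show 2 * i + 2 = 2 * (i + 1) by omega) (cupProduct (two_mul i).symm P Q)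
        (cupProduct (rfl : 1 + 1 = 2) p q) =
      ((-1 : R) ^ i) • cupProduct (two_mul (i + 1)).symm
        (cupProduct (Nat.add_comm 1 i) p P) (cupProduct (Nat.add_comm 1 i) q Q) := by
  -- `(P ∪ Q) ∪ (p ∪ q) = P ∪ (Q ∪ (p ∪ q))`
  have h1 : cupProduct (show 2 * i + 2 = 2 * (i + 1) by omega) (cupProduct (two_mul i).symm P Q)
      (cupProduct (rfl : 1 + 1 = 2) p q) =
      cupProduct (show i + (i + 2) = 2 * (i + 1) by omega) P
        (cupProduct (rfl : i + 2 = i + 2) Q (cupProduct (rfl : 1 + 1 = 2) p q)) :=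
    cupProduct_assoc _ _ _ _ P Q _
  -- `Q ∪ (p ∪ q) = (Q ∪ p) ∪ q = (-1)^i (p ∪ Q) ∪ q = (-1)^i p ∪ (Q ∪ q) = q ∪ Q`-swap later
  have h2 : cupProduct (rfl : i + 2 = i + 2) Q (cupProduct (rfl : 1 + 1 = 2) p q) =
      cupProduct (rfl : i + 1 + 1 = i + 2) (cupProduct (rfl : i + 1 = i + 1) Q p) q :=
    (cupProduct_assoc _ _ _ _ Q p q).symm
  have h3 : cupProduct (rfl : i + 1 = i + 1) Q p = ((-1 : R) ^ i) • cupProduct (Nat.add_comm 1 i) p Q := by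
    rw [cupProduct_gradedComm_holds R T (rfl : i + 1 = i + 1) (Nat.add_comm 1 i) Q p, mul_one]
  have h4 : cupProduct (rfl : i + 1 + 1 = i + 2) (cupProduct (Nat.add_comm 1 i) p Q) q =
      cupProduct (show 1 + (i + 1) = i + 2 by omega) p (cupProduct (rfl : i + 1 = i + 1) Q q) :=
    cupProduct_assoc _ _ _ _ p Q q
  have h5 : cupProduct (rfl : i + 1 = i + 1) Q q = ((-1 : R) ^ i) • cupProduct (Nat.add_comm 1 i) q Q := by
    rw [cupProduct_gradedComm_holds R T (rfl : i + 1 = i + 1) (Nat.add_comm 1 i) Q q, mul_one]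
  -- `P ∪ (p ∪ Z) = (P ∪ p) ∪ Z = (-1)^i (p ∪ P) ∪ Z`
  have h6 : ∀ Z : singularCohomology R R T (i + 1),
      cupProduct (show i + (i + 2) = 2 * (i + 1) by omega) P (cupProduct (show 1 + (i + 1) = i + 2 by omega) p Z) =
        cupProduct (two_mul (i + 1)).symm (cupProduct (rfl : i + 1 = i + 1) P p) Z :=
    fun Z ↦ (cupProduct_assoc _ _ _ _ P p Z).symm
  have h7 : cupProduct (rfl : i + 1 = i + 1) P p = ((-1 : R) ^ i) • cupProduct (Nat.add_comm 1 i) p P := by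
    rw [cupProduct_gradedComm_holds R T (rfl : i + 1 = i + 1) (Nat.add_comm 1 i) P p, mul_one]
  rw [h1, h2, h3, LinearMap.map_smul₂, h4, map_smul, h5, map_smul, map_smul, h6, h7, LinearMap.map_smul₂,
    smul_smul, smul_smul, ← pow_add, ← pow_add, ← two_mul, pow_add, pow_mul, neg_one_sq, one_pow, one_mul]

/-- The Koszul signs: `s_{i+1} = (-1)^i s_i` for `s_i = (-1) ^ (i choose 2) = (-1)^{i(i-1)/2}`. [folklore] -/
theorem neg_one_pow_choose_two_succ (i : ℕ) :
    ((-1 : R) ^ ((i + 1).choose 2)) = (-1 : R) ^ (i.choose 2) * (-1) ^ i := by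
  rw [Nat.choose_succ_succ', Nat.choose_one_right, pow_add, mul_comm]

/-- `s_i² = 1`. [folklore] -/
theorem neg_one_pow_choose_two_mul_self (i : ℕ) :
    ((-1 : R) ^ (i.choose 2)) * (-1 : R) ^ (i.choose 2) = 1 := by
  rw [← pow_add, ← two_mul, pow_mul, neg_one_sq, one_pow]

/-- The Koszul sign `(-1) ^ (i choose 2)` is the template's `Motives.WeilCohomology.altSign i` (`s₀ = 1`,
`s_{i+1} = (-1)^i s_i`), cast to `R`. [folklore] -/
theorem altSign_cast_eq_neg_one_pow_choose_two (i : ℕ) : ((WeilCohomology.altSign i : ℤ) : R) = (-1 : R) ^ (i.choose 2) := by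
  induction i with
  | zero => simp
  | succ i ih => rw [WeilCohomology.altSign_succ, Int.cast_mul, ih, Int.cast_pow, Int.cast_neg, Int.cast_one,
      neg_one_pow_choose_two_succ, mul_comm]

/-- **Koszul expansion of the powers of a sum of products of degree-one classes** (any space `T`, any
commutative coefficient ring): for `p q : Fin n → H¹(T; R)`,
`(Σ_a p_a ∪ q_a)^i = (-1)^{i(i-1)/2} • Σ_{c : Fin i → Fin n} m_i(p ∘ c) ∪ m_i(q ∘ c)`, where `x^i` is the tree's
`CharacteristicClasses.cupPow` (degree `2 i`) and `m_i` the tree's iterated product `SingularHomology.cupPowOne` (degree `i`).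
(Non-injective `c` contribute `0` when `2` is invertible, but the identity holds as stated over all `c`.)  Template:
`Motives.WeilCohomology.pow_polClass_eq_sum` for an abstract Weil cohomology. [cite: MumfordAV1970, §1 (4)] [cite: Kleiman1968AlgebraicCycles, App. 2A (2A8–2A11)] -/
theorem cupPow_sum_cup_eq {n : ℕ} (p q : Fin n → singularCohomology R R T 1) (i : ℕ) :
    cupPow R (∑ a, cupProduct (rfl : 1 + 1 = 2) (p a) (q a)) i =
      ((-1 : R) ^ (i.choose 2)) • ∑ c : Fin i → Fin n,
        cupProduct (two_mul i).symm (cupPowOne R T i (fun k ↦ p (c k))) (cupPowOne R T i (fun k ↦ q (c k))) := by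
  induction i with
  | zero =>
    rw [cupPow_zero, Nat.choose_zero_succ, pow_zero, one_smul, Fintype.sum_unique, cupPowOne_zero, cupPowOne_zero]
    exact (one_cupProduct _).symm
  | succ i ih =>
    rw [cupPow_succ, ih, LinearMap.map_smul₂, LinearMap.map_sum₂, neg_one_pow_choose_two_succ, mul_smul,
      ← WeilCohomology.sum_sum_cons, Finset.smul_sum (s := (Finset.univ : Finset (Fin n)))]
    congr 1
    simp only [map_sum]
    rw [Finset.sum_comm]
    refine Finset.sum_congr rfl fun a _ ↦ ?_
    rw [Finset.smul_sum]
    refine Finset.sum_congr rfl fun c _ ↦ ?_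
    rw [cup_cup_cup_cup_one_one, cupProduct_cupPowOne, cupProduct_cupPowOne, ← WeilCohomology.comp_cons_eq p a c,
      ← WeilCohomology.comp_cons_eq q a c]

end Koszul

/-! ### The polar family: `ℓ(θ) = Σ_a pr₁^* b_a ∪ pr₂^* y_a` along a basis `b` of `H¹` -/

section PolarFamily

open scoped MonObj

variable (A : AbelianVariety ℂ)

/-- The Poincaré class of `v₀ ∪ v₁` expanded along a basis `b` of `H¹(A(ℂ); ℚ)`:
`ℓ(v₀ ∪ v₁) = Σ_a pr₁^* b_a ∪ pr₂^* (v₀^a v₁ - v₁^a v₀)` (`v^a` = the `a`-th coordinate of `v` in `b`). [cite: MumfordAV1970, §1 (2)–(4)] -/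
theorem polClass_cup_one_one_eq_sum {n : ℕ} (b : Module.Basis (Fin n) ℚ (bettiCohomology A.X 1))
    (v₀ v₁ : bettiCohomology A.X 1) :
    BettiUniverse.pull μ[A.X] 2 (BettiUniverse.cup A.X 1 1 v₀ v₁) -
        BettiUniverse.pull (fst A.X A.X) 2 (BettiUniverse.cup A.X 1 1 v₀ v₁) -
        BettiUniverse.pull (snd A.X A.X) 2 (BettiUniverse.cup A.X 1 1 v₀ v₁) =
      ∑ a, BettiUniverse.cup (A.X ⊗ A.X) 1 1 (BettiUniverse.pull (fst A.X A.X) 1 (b a))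
        (BettiUniverse.pull (snd A.X A.X) 1 (b.repr v₀ a • v₁ - b.repr v₁ a • v₀)) := by
  rw [polClass_cup_one_one]
  -- expand the first slot along `b`
  have h₁ : ∀ w v : bettiCohomology A.X 1,
      BettiUniverse.cup (A.X ⊗ A.X) 1 1 (BettiUniverse.pull (fst A.X A.X) 1 v) (BettiUniverse.pull (snd A.X A.X) 1 w) =
        ∑ a, b.repr v a • BettiUniverse.cup (A.X ⊗ A.X) 1 1 (BettiUniverse.pull (fst A.X A.X) 1 (b a))
          (BettiUniverse.pull (snd A.X A.X) 1 w) := by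
    intro w v
    conv_lhs => rw [← b.sum_repr v]
    rw [map_sum, LinearMap.map_sum₂]
    refine Finset.sum_congr rfl fun a _ ↦ ?_
    rw [map_smul, LinearMap.map_smul₂]
  rw [h₁ v₁ v₀, h₁ v₀ v₁, ← Finset.sum_sub_distrib]
  refine Finset.sum_congr rfl fun a _ ↦ ?_
  simp only [map_sub, map_smul]

/-- **Existence of the polar family.** For a basis `b` of `H¹(A(ℂ); ℚ)` indexed by `Fin n` and any `θ ∈ H²(A(ℂ); ℚ)`
there is a family `y : Fin n → H¹(A(ℂ); ℚ)` with `m^*θ - pr₁^*θ - pr₂^*θ = Σ_a pr₁^* b_a ∪ pr₂^* y_a` (for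
`θ = Σ_{a<a'} θ_{aa'} b_a ∪ b_{a'}`: `y_a = Σ_{a'} E_{aa'} b_{a'}` with `E` the alternating matrix of `θ`; template
`Motives.WeilCohomology.polClass_eq_sum` with the polarization basis `y_a = D_{b^*_a} η`).  Proof: `H²(A(ℂ); ℚ)` is spanned by
cups of degree-one classes (`span_range_cupPowOne_rat_eq_top`, i.e. `H• = ⋀• H¹` rationally) and `polClass_cup_one_one_eq_sum`.
[cite: MumfordAV1970, §1 (4) and §6] -/
theorem exists_polClass_eq_sum {n : ℕ} (b : Module.Basis (Fin n) ℚ (bettiCohomology A.X 1))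
    (θ : bettiCohomology A.X 2) :
    ∃ y : Fin n → bettiCohomology A.X 1,
      BettiUniverse.pull μ[A.X] 2 θ - BettiUniverse.pull (fst A.X A.X) 2 θ - BettiUniverse.pull (snd A.X A.X) 2 θ =
        ∑ a, BettiUniverse.cup (A.X ⊗ A.X) 1 1 (BettiUniverse.pull (fst A.X A.X) 1 (b a))
          (BettiUniverse.pull (snd A.X A.X) 1 (y a)) := by
  have hθ : θ ∈ Submodule.span ℚ (Set.range (cupPowOne ℚ (ComplexPoints A.X) 2)) := by
    rw [span_range_cupPowOne_rat_eq_top A 2]; exact Submodule.mem_top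
  induction hθ using Submodule.span_induction with
  | mem x hx =>
    obtain ⟨v, rfl⟩ := hx
    refine ⟨fun a ↦ b.repr (v 0) a • v 1 - b.repr (v 1) a • v 0, ?_⟩
    rw [← polClass_cup_one_one_eq_sum A b (v 0) (v 1), cupPowOne_succ, cupPowOne_one]
    rfl
  | zero => exact ⟨0, by simp⟩
  | add x x' _ _ hx hx' =>
    obtain ⟨y, hy⟩ := hx
    obtain ⟨y', hy'⟩ := hx'
    refine ⟨y + y', ?_⟩
    simp only [map_add, Pi.add_apply, Finset.sum_add_distrib, ← hy, ← hy']
    abel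
  | smul r x _ hx =>
    obtain ⟨y, hy⟩ := hx
    refine ⟨r • y, ?_⟩
    simp only [map_smul, Pi.smul_apply, ← Finset.smul_sum, ← hy, smul_sub]

end PolarFamily

/-! ### Algebraicity of `Σ_c pr₁^* m_i(b ∘ c) ∪ pr₂^* m_i(y ∘ c) = s_i ℓ(θ)^i` -/

section Powers

open scoped MonObj

/-- **Cup powers of a rational algebraic divisor class are rational algebraic**: `x ∈ A¹(X)_ℚ ⇒ x^j ∈ Aʲ(X)_ℚ`
(`1 ∈ N⁰H⁰`, `algebraicClasses_zero`; and `Nʲ ∪ N¹ ⊆ N^{j+1}`, the tree's theorem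
`Voisin2003_cupProduct_algebraicClasses_holds`, Voisin II Prop. 9.20 / Fulton Cor. 19.2 (b)). -/
theorem cupPow_mem_ratAlgebraicClasses {n : ℕ} {X : SchemeOver ℂ} (hX : IsSmoothProjective n X)
    {x : bettiCohomology X 2} (hx : x ∈ ratAlgebraicClasses X 1) :
    ∀ j : ℕ, cupPow ℚ x j ∈ ratAlgebraicClasses X j
  | 0 => by
    rw [mem_ratAlgebraicClasses_iff, cupPow_zero, algebraicClasses_zero]
    exact Submodule.mem_top
  | j + 1 => by
    have hj := cupPow_mem_ratAlgebraicClasses hX hx j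
    rw [mem_ratAlgebraicClasses_iff] at hj hx ⊢
    rw [cupPow_succ, ofRatClass_eq_ringChange, singularCohomology.ringChange_cupProduct, ← ofRatClass_eq_ringChange,
      ← ofRatClass_eq_ringChange]
    exact Summit.HodgeConjecture.HodgeConjecture.Theorems.Voisin2003_cupProduct_algebraicClasses_holds hX hj hx

variable (A : AbelianVariety ℂ)

/-- `pr^* m_i(v) = m_i(pr^* ∘ v)`: pull-back of an iterated product of degree-one classes along a morphism of
`ℂ`-schemes, on the model's carriers (the tree's `SingularHomology.map_cupPowOne`). [cite: HatcherAT2002, §3.2 Prop. 3.10] -/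
theorem pull_cupPowOne {X Y : SchemeOver ℂ} (f : X ⟶ Y) (i : ℕ) (v : Fin i → bettiCohomology Y 1) :
    BettiUniverse.pull f i (cupPowOne ℚ (ComplexPoints Y) i v) =
      cupPowOne ℚ (ComplexPoints X) i (fun k ↦ BettiUniverse.pull f 1 (v k)) :=
  map_cupPowOne (AlgPoints.mapContinuous (L := ℂ) f) i v

/-- **`Σ_c pr₁^* m_i(b ∘ c) ∪ pr₂^* m_i(y ∘ c) = s_i • ℓ(θ)^i`** (`s_i = (-1)^{i(i-1)/2}`): for ANY families
`b, y : Fin n → H¹(A(ℂ); ℚ)` with `ℓ(θ) = Σ_a pr₁^* b_a ∪ pr₂^* y_a`, the sum over all `c : Fin i → Fin n` of the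
exterior cup products of the iterated products is `± ℓ(θ)^i` (Koszul expansion `cupPow_sum_cup_eq` on `(A × A)(ℂ)`,
naturality of `m_i`, `s_i² = 1`).  This is the class by which K-a's Fourier-type operator
`F(z) = Σ_c tr(z ∪ m_i(b ∘ c)) • m_i(y ∘ c)` is induced (template `isInducedBy_fourierOp`,
`isAlgebraicOperator_fourierOp`). [cite: Kleiman1968AlgebraicCycles, App. 2A (2A8–2A11)] [cite: MumfordAV1970, §16] -/
theorem sum_pull_cupPowOne_cup_eq_smul_cupPow {n : ℕ} (b y : Fin n → bettiCohomology A.X 1)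
    {θ : bettiCohomology A.X 2}
    (hℓ : BettiUniverse.pull μ[A.X] 2 θ - BettiUniverse.pull (fst A.X A.X) 2 θ - BettiUniverse.pull (snd A.X A.X) 2 θ =
      ∑ a, BettiUniverse.cup (A.X ⊗ A.X) 1 1 (BettiUniverse.pull (fst A.X A.X) 1 (b a))
        (BettiUniverse.pull (snd A.X A.X) 1 (y a)))
    (i : ℕ) :
    ∑ c : Fin i → Fin n, Literature.AlgebraicGeometry.Motives.bettiCup (two_mul i).symm
        (BettiUniverse.pull (fst A.X A.X) i (cupPowOne ℚ (ComplexPoints A.X) i (fun k ↦ b (c k))))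
        (BettiUniverse.pull (snd A.X A.X) i (cupPowOne ℚ (ComplexPoints A.X) i (fun k ↦ y (c k)))) =
      ((-1 : ℚ) ^ (i.choose 2)) •
        cupPow ℚ (BettiUniverse.pull μ[A.X] 2 θ - BettiUniverse.pull (fst A.X A.X) 2 θ -
          BettiUniverse.pull (snd A.X A.X) 2 θ) i := by
  have h := cupPow_sum_cup_eq (R := ℚ) (T := ComplexPoints (A.X ⊗ A.X))
    (fun a ↦ BettiUniverse.pull (fst A.X A.X) 1 (b a)) (fun a ↦ BettiUniverse.pull (snd A.X A.X) 1 (y a)) i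
  rw [hℓ]
  change _ = _ • cupPow ℚ (∑ a, cupProduct (rfl : 1 + 1 = 2) (BettiUniverse.pull (fst A.X A.X) 1 (b a))
    (BettiUniverse.pull (snd A.X A.X) 1 (y a))) i
  rw [h, smul_smul, neg_one_pow_choose_two_mul_self, one_smul]
  refine Finset.sum_congr rfl fun c _ ↦ ?_
  rw [pull_cupPowOne, pull_cupPowOne]

/-- **K-b (algebraicity of the Fourier kernel).** For `θ ∈ A¹(A)_ℚ` and families `b, y : Fin n → H¹(A(ℂ); ℚ)` with
`m^*θ - pr₁^*θ - pr₂^*θ = Σ_a pr₁^* b_a ∪ pr₂^* y_a` (e.g. `b` a basis and `y` its polar family, `exists_polClass_eq_sum`),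
the class `Σ_{c : Fin i → Fin n} pr₁^* m_i(b ∘ c) ∪ pr₂^* m_i(y ∘ c) ∈ H^{2i}((A × A)(ℂ); ℚ)` is a rational algebraic class of
codimension `i` on `A × A` (it is `± ℓ(θ)^i`, a power of the algebraic class `ℓ(θ)`).  Template:
`Motives.WeilCohomology.isAlgebraicOperator_fourierOp`. [cite: Kleiman1968AlgebraicCycles, App. 2A (2A8–2A11)] [cite: MumfordAV1970, §16] -/
theorem sum_pull_cupPowOne_cup_mem_ratAlgebraicClasses {θ : bettiCohomology A.X 2}
    (hθ : θ ∈ ratAlgebraicClasses A.X 1) {n : ℕ} (b y : Fin n → bettiCohomology A.X 1)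
    (hℓ : BettiUniverse.pull μ[A.X] 2 θ - BettiUniverse.pull (fst A.X A.X) 2 θ - BettiUniverse.pull (snd A.X A.X) 2 θ =
      ∑ a, BettiUniverse.cup (A.X ⊗ A.X) 1 1 (BettiUniverse.pull (fst A.X A.X) 1 (b a))
        (BettiUniverse.pull (snd A.X A.X) 1 (y a)))
    (i : ℕ) :
    ∑ c : Fin i → Fin n, Literature.AlgebraicGeometry.Motives.bettiCup (two_mul i).symm
        (BettiUniverse.pull (fst A.X A.X) i (cupPowOne ℚ (ComplexPoints A.X) i (fun k ↦ b (c k))))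
        (BettiUniverse.pull (snd A.X A.X) i (cupPowOne ℚ (ComplexPoints A.X) i (fun k ↦ y (c k)))) ∈
      ratAlgebraicClasses (A.X ⊗ A.X) i := by
  have hA : IsSmoothProjective A.dim A.X := AbelianVariety.isSmoothProjective_holds (A := A)
  rw [sum_pull_cupPowOne_cup_eq_smul_cupPow A b y hℓ i]
  exact Submodule.smul_mem _ _
    (cupPow_mem_ratAlgebraicClasses (IsSmoothProjective.tensor_holds hA hA) (polClass_mem_ratAlgebraicClasses A hθ) i)

end Powers

end Summit.HodgeConjecture.CorCM.Model

end
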